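import Summits.CriticalPhenomena.PercolationContinuityZ3.Theorems.PercNearOneGluingNoHeavyLowerTailSahiSliceMinimumCritical
import Summits.CriticalPhenomena.PercolationContinuityZ3.Theorems.SahiMasterFamilyComparableStep

/-!
# `NoHeavyLowerTail` (crux stmt-CriticalPhenomena-4575), Sahi programme P2 (gen 18): THE WEIGHTED-LAPLACIAN PRINCIPLE AT CRITICAL
# POINTS — typed, reduced to Kahn's Conjecture 5, and proved for four families

Support file (`--supports stmt-CriticalPhenomena-4575`; companion of `…SahiSliceMinimumCritical` (gen 17)).  Nothing here asserts
Kahn's or Sahi's conjecture: the principle is TYPED (`@[conjecture]`) and the file proves its REDUCTION and four solved families.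

THE STATEMENT (`WeightedLaplacianPrinciple`, "W-LAP-crit"; this lane, gen 17 census / gen 18 typing).  For a product measure `μ_p`
with a live coin and three increasing events write `Φ_e` for the fibre cubic of coin `e` (`cubicE3`) and
`W := Σ_{e live} p_e(1−p_e)·Φ_e″(p_e)` (the `q(1−q)`-weighted Laplacian of `q ↦ E₃(μ_q)`; in Fourier terms six times the trace of the
level-`(1,1)` block of the three-copy kernel, memo §2b).  **W-LAP-crit: if every live fibre is stationary (`Φ_e′(p_e) = 0`), then `W ≤ 0`.**
It trivially implies `NoInteriorAxisMinimum` (a positive combination of the `Φ_e″` is `≤ 0`, so one of them is), hence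
`MasterFamilyNonneg 3` / Kahn's Conjecture 5 / Sahi's `C₃` through the gen-17 reduction (`weightedLaplacian` lemmas below).

WHY THIS FORM (gen 18 audit, memo FROM-prim-masterthm-p2-g18-VERTEX-AVERAGES.md §1).  (i) The induction behind `…_of_noInteriorAxisMinimum` needs the sign of
some `Φ_e″` at a HYPOTHETICAL critical point where `E₃ < 0`; a certificate `W ≤ −c·E₃` with `c > 0` (the LP margin of gen 17) is silent there,
so the statement to prove is the sign-free `W ≤ 0` — for which degree-6 Bernstein certificates with affine multipliers exist on EVERY 3-coin
triple (kit j169275: 365/365 classes, `c = 0`).  (ii) NEW READING (gen 18): with `Ξ_q(s) := E_{w∼μ_q} E₃(μ_{q+s(w−q)})` (the `μ_q`-average of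
`E₃` over the cube shrunk towards its vertices; equivalently `E[K]` for three `s`-noisy copies of one sample) one has `Ξ_q(0) = E₃(μ_q)`,
`Ξ_q(1) = 0`, `Ξ_q′(0) = 0`, `Ξ_q″(0) = W(q)` and `Ξ_q′(1) = −Σ_e q_e(1−q_e)[2Σ_k μ(U_k⁰∩P_i∩P_j) + 3μ(P₁∩P₂∩P₃)] ≤ 0` (`P_i` = pivotal set of
`e` for `U_i`); census (≈ 3.8·10⁵ random points, ≈ 1.1·10⁴ interior critical points, `m ≤ 6`): `Ξ_q` is ALWAYS unimodal on `[0,1]`, is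
non-increasing EXACTLY when `W(q) ≤ 0`, and is non-increasing at every interior critical point — so W-LAP-crit says "at a critical point
`E₃` dominates all its vertex-directed averages", a mean-value inequality.  (iii) Census for W-LAP-crit itself (gen 17): ≈ 1.9·10⁶ adversarial
interior critical points `m ≤ 12`, 0 violations, `W ≤ −1.05·E₃` throughout.

PROVED FAMILIES (every live axis is individually non-convex at a stationary point, so `W ≤ 0` termwise): a constant member
(`cubicE3Deriv2_const`: `Φ″ = −2Δ_UΔ_V` identically), diagonal triples (gen 17 `cubicE3Deriv2_diag_nonpos`), pair triples (gen 17
`cubicE3Deriv2_nonpos_of_stationary_pair`), and CHAINS `U₁ ⊆ U₂ ⊆ U₃` (`cubicE3Deriv2_nonpos_of_stationary_chain`, new: stationarity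
`Δ₁(1−m₂)(2−m₃) = m₁[Δ₂(2−m₃) + (1−m₂)Δ₃]` gives `(1−m₂)(2−m₃)·½Φ″ = −m₁(X² + XY + Y²)` with `X = Δ₂(2−m₃)`, `Y = (1−m₂)Δ₃`).  For general
triples single axes CAN be convex at a critical point (census: 1,181 of 8,607 critical points, all but 6 at dummy axes) — only the weighted
sum is signed.  HONEST LABEL: a typed conjecture with its reduction and four solved families; `C₃` remains OPEN. [this work]
-/

noncomputable section

open scoped Classical Topology

namespace Summit.CriticalPhenomena.PercolationContinuityZ3.Theorems

open Finset Function Filter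
open Literature.Combinatorics.Sahi2008
open Literature.Probability.Percolation.DecisionTree (ind ind_of_mem ind_of_not_mem ind_nonneg)

namespace SahiSliceMinimum

variable {ι : Type} [Fintype ι]

/-! ### The statement (typed) -/

/-- **THE WEIGHTED-LAPLACIAN PRINCIPLE AT CRITICAL POINTS (W-LAP-crit)** (this lane): for every finite `ι`, every `p : ι → [0,1]` with a
live coin and every three increasing events, if `∂E₃/∂p_e = 0` for every live coin `e` then
`Σ_{e live} p_e(1 − p_e)·∂²E₃/∂p_e² ≤ 0`.  Census-clean (≈ 1.9·10⁶ adversarial interior critical points, `m ≤ 12`); certified by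
Bernstein/LP multipliers on every 3-coin cube.  An obligation / hypothesis; never import it as a fact. [this work] [status: open; conjecture] -/
@[conjecture] def WeightedLaplacianPrinciple : Prop :=
  ∀ (ι : Type) [Fintype ι] (p : ι → unitInterval) (U : Fin 3 → Set (Set ι)),
    (∀ j, IsUpperSet (U j)) → (liveSet p).Nonempty →
      (∀ e ∈ liveSet p, fibreSlope p e (ind (U 0)) (ind (U 1)) (ind (U 2)) = 0) →
        ∑ e ∈ liveSet p, (p e : ℝ) * (1 - (p e : ℝ)) * cubicE3Deriv2 p e (ind (U 0)) (ind (U 1)) (ind (U 2)) (p e) ≤ 0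

/-! ### The reduction: W-LAP-crit ⟹ NIM ⟹ Kahn -/

/-- **W-LAP-crit implies "no interior axiswise minimum"**: a combination of the live `Φ_e″` with the positive weights `p_e(1−p_e)` is
`≤ 0`, so some live `Φ_e″ ≤ 0`. [this work] -/
theorem noInteriorAxisMinimum_of_weightedLaplacian (h : WeightedLaplacianPrinciple) : NoInteriorAxisMinimum := by
  intro ι _ p U hU hlive hstat
  have hsum := h ι p U hU hlive hstat
  by_contra hc
  simp only [not_exists, not_and, not_le] at hc
  have hpos : 0 < ∑ e ∈ liveSet p,
      (p e : ℝ) * (1 - (p e : ℝ)) * cubicE3Deriv2 p e (ind (U 0)) (ind (U 1)) (ind (U 2)) (p e) := by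
    refine Finset.sum_pos (fun e he => ?_) hlive
    have h01 := (mem_liveSet p e).1 he
    exact mul_pos (mul_pos h01.1 (by linarith [h01.2])) (hc e he)
  linarith

/-- **W-LAP-crit implies `MasterFamilyNonneg 3`.** [this work] -/
theorem masterFamilyNonneg_three_of_weightedLaplacian (h : WeightedLaplacianPrinciple) : MasterFamilyNonneg 3 :=
  masterFamilyNonneg_three_of_noInteriorAxisMinimum (noInteriorAxisMinimum_of_weightedLaplacian h)

/-- **W-LAP-crit implies Kahn's Conjecture 5.** [this work] -/
theorem kahnConjecture_of_weightedLaplacian (h : WeightedLaplacianPrinciple) : KahnConjecture :=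
  kahnConjecture_of_noInteriorAxisMinimum (noInteriorAxisMinimum_of_weightedLaplacian h)

/-- **W-LAP-crit implies Sahi's `C₃`.** [this work] -/
theorem sahiConjecture_three_of_weightedLaplacian (h : WeightedLaplacianPrinciple) : SahiConjecture 3 :=
  sahiConjecture_three_of_noInteriorAxisMinimum (noInteriorAxisMinimum_of_weightedLaplacian h)

/-- The termwise route to the W-LAP conclusion: if every live fibre is non-convex at the actual bias, the weighted Laplacian is `≤ 0`.
(Sufficient, not necessary: for general triples single axes can be convex at a critical point.) [this work] -/
theorem weightedLaplacian_nonpos_of_forall (p : ι → unitInterval) (f g h : Set ι → ℝ)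
    (hax : ∀ e ∈ liveSet p, cubicE3Deriv2 p e f g h (p e) ≤ 0) :
    ∑ e ∈ liveSet p, (p e : ℝ) * (1 - (p e : ℝ)) * cubicE3Deriv2 p e f g h (p e) ≤ 0 := by
  refine Finset.sum_nonpos fun e he => ?_
  have h0 : 0 ≤ (p e : ℝ) := (p e).2.1
  have h1 : (p e : ℝ) ≤ 1 := (p e).2.2
  exact mul_nonpos_of_nonneg_of_nonpos (mul_nonneg h0 (by linarith)) (hax e he)

/-! ### Family 1: a constant member — every fibre is concave everywhere -/

omit [Fintype ι] in
/-- The indicator of the sure event is the constant function `1`. [folklore] -/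
theorem ind_univ_eq_one : ind (Set.univ : Set (Set ι)) = (1 : Set ι → ℝ) := by
  funext ω
  exact ind_of_mem (Set.mem_univ ω)

/-- **With a constant third member the fibre cubic is a concave parabola**: `Φ″ ≡ −2·Δf·Δg` (for `(U,V,Ω)`, `E₃ = Cov(1_U,1_V)`). [this work] -/
theorem cubicE3Deriv2_const (p : ι → unitInterval) (e : ι) (f g : Set ι → ℝ) (s : ℝ) :
    cubicE3Deriv2 p e f g 1 s = -(2 * (secDelta p e f * secDelta p e g)) := by
  have h1 : ∀ b, secEx p e (1 : Set ι → ℝ) b = 1 := secEx_one p e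
  simp only [cubicE3Deriv2, secM, secDelta, mul_one, h1]
  ring

/-- Hence for increasing `U, V` the triple `(1_U, 1_V, 1)` has `Φ_e″ ≤ 0` at every coin and every bias — NIM and W-LAP hold with no
stationarity hypothesis. [this work] -/
theorem cubicE3Deriv2_const_nonpos (p : ι → unitInterval) (e : ι) {U V : Set (Set ι)} (hU : IsUpperSet U) (hV : IsUpperSet V)
    (s : ℝ) : cubicE3Deriv2 p e (ind U) (ind V) 1 s ≤ 0 := by
  rw [cubicE3Deriv2_const]
  have hΔU : 0 ≤ secDelta p e (ind U) := sub_nonneg.2 (secEx_ind_mono p e hU)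
  have hΔV : 0 ≤ secDelta p e (ind V) := sub_nonneg.2 (secEx_ind_mono p e hV)
  nlinarith [mul_nonneg hΔU hΔV]

/-- W-LAP for `(U, V, Ω)`. [this work] -/
theorem weightedLaplacian_const (p : ι → unitInterval) {U V : Set (Set ι)} (hU : IsUpperSet U) (hV : IsUpperSet V) :
    ∑ e ∈ liveSet p, (p e : ℝ) * (1 - (p e : ℝ)) * cubicE3Deriv2 p e (ind U) (ind V) (ind (Set.univ : Set (Set ι))) (p e) ≤ 0 := by
  rw [ind_univ_eq_one]
  exact weightedLaplacian_nonpos_of_forall p _ _ _ fun e _ => cubicE3Deriv2_const_nonpos p e hU hV (p e)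

/-! ### Family 2 and 3: diagonal and pair triples (the per-axis facts are gen 17's) -/

/-- W-LAP for diagonal triples `(U,U,U)` (every fibre concave, gen 17). [this work] -/
theorem weightedLaplacian_diag (p : ι → unitInterval) (U : Set (Set ι)) :
    ∑ e ∈ liveSet p, (p e : ℝ) * (1 - (p e : ℝ)) * cubicE3Deriv2 p e (ind U) (ind U) (ind U) (p e) ≤ 0 :=
  weightedLaplacian_nonpos_of_forall p _ _ _ fun e _ => cubicE3Deriv2_diag_nonpos p e U (p e)

/-- W-LAP for pair triples `(U,U,V)` at a critical point (every stationary fibre is non-convex, gen 17 `nim_pair`). [this work] -/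
theorem weightedLaplacian_pair (p : ι → unitInterval) {U V : Set (Set ι)} (hU : IsUpperSet U) (hV : IsUpperSet V)
    (hstat : ∀ e ∈ liveSet p, fibreSlope p e (ind U) (ind U) (ind V) = 0) :
    ∑ e ∈ liveSet p, (p e : ℝ) * (1 - (p e : ℝ)) * cubicE3Deriv2 p e (ind U) (ind U) (ind V) (p e) ≤ 0 :=
  weightedLaplacian_nonpos_of_forall p _ _ _ fun e he => nim_pair p hU hV he (hstat e he)

/-! ### Family 4: chains `U₁ ⊆ U₂ ⊆ U₃` — every stationary fibre point is non-convex -/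

/-- The slope of a chain's fibre: `Φ′ = Δ₁(1−m₂)(2−m₃) − m₁Δ₂(2−m₃) − m₁(1−m₂)Δ₃` (the fibre is `m₁(1−m₂)(2−m₃)`). [this work] -/
theorem cubicE3Deriv_chain_eq (p : ι → unitInterval) (e : ι) {A B C : Set (Set ι)} (hAB : A ⊆ B) (hBC : B ⊆ C) (s : ℝ) :
    cubicE3Deriv p e (ind A) (ind B) (ind C) s =
      secDelta p e (ind A) * (1 - secM p e (ind B) s) * (2 - secM p e (ind C) s) -
        secM p e (ind A) s * secDelta p e (ind B) * (2 - secM p e (ind C) s) -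
        secM p e (ind A) s * (1 - secM p e (ind B) s) * secDelta p e (ind C) := by
  have hAC : A ⊆ C := hAB.trans hBC
  have e2 : ind B * ind C = ind B := ind_mul_ind_eq_of_subset hBC
  have e3 : ind A * ind C = ind A := ind_mul_ind_eq_of_subset hAC
  have e4 : ind A * ind B = ind A := ind_mul_ind_eq_of_subset hAB
  simp only [cubicE3Deriv, e2, e3, e4, secM, secDelta]
  ring

/-- The curvature of a chain's fibre: `½Φ″ = m₁Δ₂Δ₃ − Δ₁Δ₃(1−m₂) − Δ₁Δ₂(2−m₃)`. [this work] -/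
theorem cubicE3Deriv2_chain_eq (p : ι → unitInterval) (e : ι) {A B C : Set (Set ι)} (hAB : A ⊆ B) (hBC : B ⊆ C) (s : ℝ) :
    cubicE3Deriv2 p e (ind A) (ind B) (ind C) s =
      2 * (secM p e (ind A) s * secDelta p e (ind B) * secDelta p e (ind C) -
        secDelta p e (ind A) * secDelta p e (ind C) * (1 - secM p e (ind B) s) -
        secDelta p e (ind A) * secDelta p e (ind B) * (2 - secM p e (ind C) s)) := by
  have hAC : A ⊆ C := hAB.trans hBC
  have e2 : ind B * ind C = ind B := ind_mul_ind_eq_of_subset hBC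
  have e3 : ind A * ind C = ind A := ind_mul_ind_eq_of_subset hAC
  have e4 : ind A * ind B = ind A := ind_mul_ind_eq_of_subset hAB
  simp only [cubicE3Deriv2, e2, e3, e4, secM, secDelta]
  ring

/-- **Chains: a stationary fibre point is never a strict local minimum** — for `U₁ ⊆ U₂ ⊆ U₃` increasing and `0 < s < 1`, `Φ′(s) = 0`
forces `Φ″(s) ≤ 0`, at EVERY coin.  Proof: with `X = Δ₂(2−m₃)`, `Y = (1−m₂)Δ₃`, stationarity reads `Δ₁(1−m₂)(2−m₃) = m₁(X+Y)` and then
`(1−m₂)(2−m₃)·½Φ″ = −m₁(X² + XY + Y²) ≤ 0`; if `(1−m₂)(2−m₃) = 0` then `m₂ = 1`, so `Δ₂ = 0` and `Φ″ = −2Δ₁Δ₃(1−m₂) − … ≤ 0` directly. [this work] -/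
theorem cubicE3Deriv2_nonpos_of_stationary_chain (p : ι → unitInterval) (e : ι) {A B C : Set (Set ι)} (hA : IsUpperSet A)
    (hB : IsUpperSet B) (hC : IsUpperSet C) (hAB : A ⊆ B) (hBC : B ⊆ C) (s : unitInterval)
    (h0 : cubicE3Deriv p e (ind A) (ind B) (ind C) s = 0) :
    cubicE3Deriv2 p e (ind A) (ind B) (ind C) s ≤ 0 := by
  rw [cubicE3Deriv_chain_eq p e hAB hBC] at h0
  rw [cubicE3Deriv2_chain_eq p e hAB hBC]
  have hΔA : 0 ≤ secDelta p e (ind A) := sub_nonneg.2 (secEx_ind_mono p e hA)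
  have hΔB : 0 ≤ secDelta p e (ind B) := sub_nonneg.2 (secEx_ind_mono p e hB)
  have hΔC : 0 ≤ secDelta p e (ind C) := sub_nonneg.2 (secEx_ind_mono p e hC)
  obtain ⟨a00, a01⟩ := secEx_ind_mem p e A false
  obtain ⟨a10, a11⟩ := secEx_ind_mem p e A true
  obtain ⟨b00, b01⟩ := secEx_ind_mem p e B false
  obtain ⟨b10, b11⟩ := secEx_ind_mem p e B true
  obtain ⟨c00, c01⟩ := secEx_ind_mem p e C false
  obtain ⟨c10, c11⟩ := secEx_ind_mem p e C true
  have hs0 : 0 ≤ (s : ℝ) := s.2.1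
  have hs1 : (s : ℝ) ≤ 1 := s.2.2
  have hmA : 0 ≤ secM p e (ind A) s := by unfold secM; nlinarith
  have hmB : secM p e (ind B) s ≤ 1 := by unfold secM; nlinarith
  have hmC : secM p e (ind C) s ≤ 1 := by unfold secM; nlinarith
  -- abbreviations
  set mA := secM p e (ind A) s with hmAdef
  set mB := secM p e (ind B) s with hmBdef
  set mC := secM p e (ind C) s with hmCdef
  set dA := secDelta p e (ind A) with hdA
  set dB := secDelta p e (ind B) with hdB
  set dC := secDelta p e (ind C) with hdC
  have hP : 0 ≤ (1 - mB) * (2 - mC) := mul_nonneg (by linarith) (by linarith)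
  -- the key identity: P · ½Φ″ = −m₁ (X² + XY + Y²)
  have key : (1 - mB) * (2 - mC) * (mA * dB * dC - dA * dC * (1 - mB) - dA * dB * (2 - mC)) =
      -(mA * ((dB * (2 - mC)) ^ 2 + (dB * (2 - mC)) * ((1 - mB) * dC) + ((1 - mB) * dC) ^ 2)) := by
    linear_combination (-(dB * (2 - mC)) - (1 - mB) * dC) * h0
  have hQ : 0 ≤ mA * ((dB * (2 - mC)) ^ 2 + (dB * (2 - mC)) * ((1 - mB) * dC) + ((1 - mB) * dC) ^ 2) := by
    apply mul_nonneg hmA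
    have hX : 0 ≤ dB * (2 - mC) := mul_nonneg hΔB (by linarith)
    have hY : 0 ≤ (1 - mB) * dC := mul_nonneg (by linarith) hΔC
    nlinarith [mul_nonneg hX hY]
  rcases eq_or_lt_of_le hP with hP0 | hPpos
  · -- degenerate case: (1 - mB)(2 - mC) = 0 forces mB = 1; stationarity then gives mA·Δ_B = 0
    have h2C : 0 < 2 - mC := by linarith
    have h1B : 1 - mB = 0 := by
      rcases mul_eq_zero.1 hP0.symm with h | h
      · exact h
      · exact absurd h (ne_of_gt h2C)
    rw [h1B] at h0
    have hst : mA * dB * (2 - mC) = 0 := by linear_combination -h0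
    have hmAdB : mA * dB = 0 := by
      rcases mul_eq_zero.1 hst with h | h
      · exact h
      · exact absurd h (ne_of_gt h2C)
    rw [h1B]
    rcases mul_eq_zero.1 hmAdB with hmA0 | hdB0
    · rw [hmA0]
      nlinarith [mul_nonneg (mul_nonneg hΔA hΔB) h2C.le]
    · rw [hdB0]
      simp
  · -- generic case: divide the key identity by P > 0
    have hle : (1 - mB) * (2 - mC) * (mA * dB * dC - dA * dC * (1 - mB) - dA * dB * (2 - mC)) ≤ 0 := by
      rw [key]; linarith
    have hbr : mA * dB * dC - dA * dC * (1 - mB) - dA * dB * (2 - mC) ≤ 0 := by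
      by_contra hc
      have : 0 < (1 - mB) * (2 - mC) * (mA * dB * dC - dA * dC * (1 - mB) - dA * dB * (2 - mC)) :=
        mul_pos hPpos (not_le.1 hc)
      linarith
    linarith

/-- **NIM / W-LAP for chains**: at a critical point every live fibre of `(1_{U₁},1_{U₂},1_{U₃})`, `U₁ ⊆ U₂ ⊆ U₃` increasing, is
non-convex, so the weighted Laplacian is `≤ 0`. [this work] -/
theorem weightedLaplacian_chain (p : ι → unitInterval) {A B C : Set (Set ι)} (hA : IsUpperSet A) (hB : IsUpperSet B)
    (hC : IsUpperSet C) (hAB : A ⊆ B) (hBC : B ⊆ C)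
    (hstat : ∀ e ∈ liveSet p, fibreSlope p e (ind A) (ind B) (ind C) = 0) :
    ∑ e ∈ liveSet p, (p e : ℝ) * (1 - (p e : ℝ)) * cubicE3Deriv2 p e (ind A) (ind B) (ind C) (p e) ≤ 0 := by
  refine weightedLaplacian_nonpos_of_forall p _ _ _ fun e he => ?_
  have h0 := hstat e he
  rw [fibreSlope_eq] at h0
  exact cubicE3Deriv2_nonpos_of_stationary_chain p e hA hB hC hAB hBC (p e) h0

end SahiSliceMinimum

end Summit.CriticalPhenomena.PercolationContinuityZ3.Theorems
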